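import Mathlib
import Summits.NavierStokesRegularity.NavierStokesRegularity.Theses.LandauTail
import Summits.NavierStokesRegularity.NavierStokesRegularity.Theorems.LandauTailLandauTailBlowupTightCut
import Summits.NavierStokesRegularity.NavierStokesRegularity.Theorems.LandauTailHomSteadyProfileExists
import Literature.Analysis.FluidPDE.LandauSolutions
import Literature.Analysis.FluidPDE.SverakLandauClassificationProofs
import Literature.Analysis.FluidPDE.IsometryInvariance

/-!
# NavierStokesRegularity — route `LandauTail`, crux `LandauTailBlowup`: the Landau normal form

Helper file for the crux item `stmt-NavierStokesRegularity-1944` (`LandauTail.LandauTailBlowup`, line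
`registered` = `Cruxes/LandauTailBlowup/Lines/birth.lean`, cut `X ⇐ LandauTailLocal ∧ LandauTailTransfer`,
proved tight in `LandauTailLandauTailBlowupTightCut`). The route types its items over the ABSTRACT profile
class "`(U, P)` smooth on `ℝ³ ∖ {0}`, `(U·∇)U + ∇P = ν ΔU` and `div U = 0` off the origin,
`U (c • x) = c⁻¹ • U x` (`c > 0`), `U ≠ 0`". Two theorems now PROVED in the tree collapse this class
onto Landau's explicit one-parameter family:

* Šverák's classification (V. Šverák, J. Math. Sci. 179 (2011), Thm 1; tree:
  `Literature.Analysis.FluidPDE.Sverak2011_landauClassification_holds` and its corollary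
  `Sverak2011_landauClassification.of_profile`): every member of the class is
  `ν • landauAxisField a A` on `{0}ᶜ` for a unit axis `a` and a parameter `A > 1`;
* Landau's theorem (L. D. Landau 1944; Lemarié-Rieusset 2016, Thm 10.13; tree:
  `LandauTail.landauAxisField_momentum`, `LandauTail.divergence_landauAxisField`, files
  `LandauTailHomSteadyProfileExists*`): every
  `landauAxisField a A` (`‖a‖ = 1`, `A > 1`) is in the class.

Consequences proved here (sorry-free):

* `landauTail_profile_smul` — the class is covariant under `(U, P, μ) ↦ (c U, c² P, c μ)`, `c > 0`;
* `landauTail_landauAxisField_profile`, `landauTail_smul_landauAxisField_profile` — Landau's family is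
  in the class (viscosity `1`, resp. `ν`);
* `landauTail_exists_axis_of_profile` — Šverák's normal form of a member of the class;
* `landauTailBlowup_iff_landauAxisField` — **the crux in Landau normal form**: `LandauTailBlowup` iff a
  Clay-data classical Leray–Hopf solution has, at some `(xs, T)`, the parabolic tail
  `√(T−t) u(t, xs + √(T−t) y) → ν • landauAxisField a A y` (`y ≠ 0`) for a unit axis `a` and `A > 1`;
* `landauTailLocal_iff_landauSolution` — **the singularity model is a one-parameter problem with a
  fixed axis**: `LandauTailLocal` iff for some `A > 1` a unit-viscosity classical solution on
  `ℝ³ × (−1, 0)` with Tsai's local energy bounds on `B₁` has the tail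
  `√(−t) u(t, √(−t) y) → landauSolution 1 A y` (`y ≠ 0`; Lemarié-Rieusset's (10.44), axis `e₃`) — the
  axis is removed by the rotation covariance of the Navier–Stokes equations
  (`IsClassicalNSSolutionOn.conj_linearIsometryEquiv`) and of the Tsai bounds;
* `landauTailBlowup_iff_landauSolution_local_and_transfer` — through the tight cut, the crux is
  `(∃ A > 1, the one-parameter local model) ∧ LandauTailTransfer`.

References: L. D. Landau, Dokl. Akad. Nauk SSSR 43 (1944) 286–288; V. Šverák, arXiv:math/0604550, Thm 1;
P. G. Lemarié-Rieusset, *The Navier–Stokes problem in the 21st century* (2016), Thm 10.13, (10.44), p. 318;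
A. Majda, A. Bertozzi, *Vorticity and Incompressible Flow* (2002), §1.2 Prop. 1.1 (iii) (rotation symmetry);
T.-P. Tsai, ARMA 143 (1998), Thm 2 (local energy class).
-/

noncomputable section

open Filter Set Topology MeasureTheory Metric
open scoped ENNReal NNReal InnerProductSpace RealInnerProductSpace Laplacian
open Literature.Analysis.FluidPDE

-- the summit-side namespace repeats a component by design (D-0017)
set_option linter.dupNamespace false

namespace Summit.NavierStokesRegularity.NavierStokesRegularity.Theorems

/-! ### The profile class: scaling covariance, Landau's family, Šverák's normal form -/

/-- `{0}ᶜ = {x | x ≠ 0}` (the route writes the former, `SverakLandauClassification` the latter). [folklore] -/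
theorem landauTail_compl_zero_eq :
    ({0}ᶜ : Set (EuclideanSpace ℝ (Fin 3))) = {x | x ≠ 0} := by
  ext x
  simp

/-- **Scaling covariance of the profile class.** If `(U, P)` is smooth off the origin, solves
`(U·∇)U + ∇P = μ ΔU`, `div U = 0` off the origin, is homogeneous of degree `-1` and nonzero, then for
`c > 0` the pair `(c U, c² P)` has the same properties with viscosity `c μ` (every term of the momentum
equation scales by `c²`). [folklore] -/
theorem landauTail_profile_smul {μ c : ℝ} (hc : 0 < c)
    {U : EuclideanSpace ℝ (Fin 3) → EuclideanSpace ℝ (Fin 3)} {P : EuclideanSpace ℝ (Fin 3) → ℝ}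
    (hU : ContDiffOn ℝ (⊤ : ℕ∞) U {0}ᶜ) (hP : ContDiffOn ℝ (⊤ : ℕ∞) P {0}ᶜ)
    (hNS : ∀ x : EuclideanSpace ℝ (Fin 3), x ≠ 0 →
      convect U U x + gradient P x = μ • Laplacian.laplacian U x)
    (hdiv : ∀ x : EuclideanSpace ℝ (Fin 3), x ≠ 0 → VectorCalculus.divergence U x = 0)
    (hhom : ∀ c : ℝ, 0 < c → ∀ x : EuclideanSpace ℝ (Fin 3), U (c • x) = c⁻¹ • U x)
    (hne : ∃ x : EuclideanSpace ℝ (Fin 3), U x ≠ 0) :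
    ContDiffOn ℝ (⊤ : ℕ∞) (fun x => c • U x) {0}ᶜ ∧
    ContDiffOn ℝ (⊤ : ℕ∞) (fun x => c ^ 2 * P x) {0}ᶜ ∧
    (∀ x : EuclideanSpace ℝ (Fin 3), x ≠ 0 →
      convect (fun x => c • U x) (fun x => c • U x) x + gradient (fun x => c ^ 2 * P x) x =
        (c * μ) • Laplacian.laplacian (fun x => c • U x) x) ∧
    (∀ x : EuclideanSpace ℝ (Fin 3), x ≠ 0 → VectorCalculus.divergence (fun x => c • U x) x = 0) ∧
    (∀ d : ℝ, 0 < d → ∀ x : EuclideanSpace ℝ (Fin 3),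
      (fun x => c • U x) (d • x) = d⁻¹ • (fun x => c • U x) x) ∧
    (∃ x : EuclideanSpace ℝ (Fin 3), (fun x => c • U x) x ≠ 0) := by
  have hc0 : c ≠ 0 := hc.ne'
  refine ⟨hU.const_smul c, contDiffOn_const.mul hP, ?_, ?_, ?_, ?_⟩
  · intro x hx
    have hxmem : ({0}ᶜ : Set (EuclideanSpace ℝ (Fin 3))) ∈ 𝓝 x := isOpen_compl_singleton.mem_nhds hx
    have hUd : DifferentiableAt ℝ U x := (hU.differentiableOn (by simp)).differentiableAt hxmem
    have hPd : DifferentiableAt ℝ P x := (hP.differentiableOn (by simp)).differentiableAt hxmem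
    have hU2 : ContDiffAt ℝ 2 U x := (hU.of_le (by norm_cast)).contDiffAt hxmem
    -- convective term
    have hconv : convect (fun x => c • U x) (fun x => c • U x) x = (c * c) • convect U U x := by
      simp only [convect_apply]
      rw [fderiv_fun_const_smul hUd, FunLike.coe_smul, Pi.smul_apply, map_smul, smul_smul]
    -- pressure gradient
    have hgrad : gradient (fun x => c ^ 2 * P x) x = (c * c) • gradient P x := by
      have := gradient_const_smul hPd (c ^ 2)
      simp only [smul_eq_mul] at this
      rw [this, sq]
    -- Laplacian
    have hlap : Laplacian.laplacian (fun x => c • U x) x = c • Laplacian.laplacian U x :=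
      InnerProductSpace.laplacian_smul c hU2
    rw [hconv, hgrad, hlap, ← smul_add, hNS x hx, smul_smul, smul_smul]
    congr 1
    ring
  · intro x hx
    have hxmem : ({0}ᶜ : Set (EuclideanSpace ℝ (Fin 3))) ∈ 𝓝 x := isOpen_compl_singleton.mem_nhds hx
    have hUd : DifferentiableAt ℝ U x := (hU.differentiableOn (by simp)).differentiableAt hxmem
    rw [divergence_const_smul_apply hUd, hdiv x hx, mul_zero]
  · intro d hd x
    simp only
    rw [hhom d hd x, smul_comm]
  · obtain ⟨x, hx⟩ := hne
    exact ⟨x, by simpa [smul_eq_zero, hc0] using hx⟩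

/-- **Landau's family is in the profile class (viscosity `1`).** For a unit axis `a` and `A > 1`,
`(landauAxisField a A, landauAxisPressure a A)` is smooth off the origin, solves the steady unit-viscosity
Navier–Stokes system off the origin (Landau's theorem, tree `LandauTail.landauAxisField_momentum`,
`LandauTail.divergence_landauAxisField`), is homogeneous of degree `-1` for all `x` (junk value `0` at the
origin) and does not vanish at `x = a` (there it is the image under a frame `R`, `R e₃ = a`, of
`landauSolution 1 A e₃ = (4/(A−1)) e₃ ≠ 0`). [folklore] -/
theorem landauTail_landauAxisField_profile {a : EuclideanSpace ℝ (Fin 3)} (ha : ‖a‖ = 1) {A : ℝ}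
    (hA : 1 < A) :
    ContDiffOn ℝ (⊤ : ℕ∞) (landauAxisField a A) {0}ᶜ ∧
    ContDiffOn ℝ (⊤ : ℕ∞) (landauAxisPressure a A) {0}ᶜ ∧
    (∀ x : EuclideanSpace ℝ (Fin 3), x ≠ 0 →
      convect (landauAxisField a A) (landauAxisField a A) x + gradient (landauAxisPressure a A) x =
        (1 : ℝ) • Laplacian.laplacian (landauAxisField a A) x) ∧
    (∀ x : EuclideanSpace ℝ (Fin 3), x ≠ 0 → VectorCalculus.divergence (landauAxisField a A) x = 0) ∧
    (∀ c : ℝ, 0 < c → ∀ x : EuclideanSpace ℝ (Fin 3),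
      landauAxisField a A (c • x) = c⁻¹ • landauAxisField a A x) ∧
    (∃ x : EuclideanSpace ℝ (Fin 3), landauAxisField a A x ≠ 0) := by
  have hA' : 1 < |A| := lt_of_lt_of_le hA (le_abs_self A)
  refine ⟨?_, ?_, fun x hx => ?_, fun x hx => ?_, fun c hc x => landauAxisField_smul a A hc x, ?_⟩
  · rw [landauTail_compl_zero_eq]
    exact contDiffOn_landauAxisField ha hA'
  · rw [landauTail_compl_zero_eq]
    exact contDiffOn_landauAxisPressure ha hA'
  · rw [one_smul]
    exact LandauTail.landauAxisField_momentum ha hA' hx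
  · exact LandauTail.divergence_landauAxisField ha hA' hx
  · obtain ⟨R, hR⟩ := exists_linearIsometryEquiv_apply_eZ_eq ha
    refine ⟨a, fun h => ?_⟩
    have h1 : landauAxisField a A a = R (landauSolution 1 A eZ) := by
      rw [landauSolution_one, ← landauAxisField_map_linearIsometryEquiv R eZ A eZ, hR]
    have h2 : landauSolution 1 A eZ = 0 := by
      apply R.injective
      rw [← h1, h, map_zero]
    exact landauSolution_eZ_ne_zero one_ne_zero hA.ne' h2

/-- **Landau's family is in the profile class (viscosity `ν`).** For `ν > 0`, a unit axis `a` and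
`A > 1`, `(ν • landauAxisField a A, ν² landauAxisPressure a A)` solves the steady Navier–Stokes system
with viscosity `ν` off the origin and has all the other properties of the class (Landau's theorem
scaled by `landauTail_profile_smul`). [folklore] -/
theorem landauTail_smul_landauAxisField_profile {ν : ℝ} (hν : 0 < ν) {a : EuclideanSpace ℝ (Fin 3)}
    (ha : ‖a‖ = 1) {A : ℝ} (hA : 1 < A) :
    ContDiffOn ℝ (⊤ : ℕ∞) (fun x => ν • landauAxisField a A x) {0}ᶜ ∧
    ContDiffOn ℝ (⊤ : ℕ∞) (fun x => ν ^ 2 * landauAxisPressure a A x) {0}ᶜ ∧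
    (∀ x : EuclideanSpace ℝ (Fin 3), x ≠ 0 →
      convect (fun x => ν • landauAxisField a A x) (fun x => ν • landauAxisField a A x) x +
          gradient (fun x => ν ^ 2 * landauAxisPressure a A x) x =
        ν • Laplacian.laplacian (fun x => ν • landauAxisField a A x) x) ∧
    (∀ x : EuclideanSpace ℝ (Fin 3), x ≠ 0 →
      VectorCalculus.divergence (fun x => ν • landauAxisField a A x) x = 0) ∧
    (∀ c : ℝ, 0 < c → ∀ x : EuclideanSpace ℝ (Fin 3),
      (fun x => ν • landauAxisField a A x) (c • x) = c⁻¹ • (fun x => ν • landauAxisField a A x) x) ∧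
    (∃ x : EuclideanSpace ℝ (Fin 3), (fun x => ν • landauAxisField a A x) x ≠ 0) := by
  obtain ⟨hU, hP, hNS, hdiv, hhom, hne⟩ := landauTail_landauAxisField_profile ha hA
  have h := landauTail_profile_smul (μ := 1) hν hU hP hNS hdiv hhom hne
  rw [mul_one] at h
  exact h

/-- **Šverák's normal form of a profile** (Šverák 2011, Thm 1, PROVED in the tree as
`Sverak2011_landauClassification_holds`; corollary `….of_profile`): a member `(U, P)` of the route's
profile class with viscosity `ν > 0` equals `ν • landauAxisField a A` off the origin for a unit axis `a`
and a parameter `A > 1`. [folklore] -/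
theorem landauTail_exists_axis_of_profile {ν : ℝ} (hν : 0 < ν)
    {U : EuclideanSpace ℝ (Fin 3) → EuclideanSpace ℝ (Fin 3)} {P : EuclideanSpace ℝ (Fin 3) → ℝ}
    (hU : ContDiffOn ℝ (⊤ : ℕ∞) U {0}ᶜ) (hP : ContDiffOn ℝ (⊤ : ℕ∞) P {0}ᶜ)
    (hNS : ∀ x : EuclideanSpace ℝ (Fin 3), x ≠ 0 →
      convect U U x + gradient P x = ν • Laplacian.laplacian U x)
    (hdiv : ∀ x : EuclideanSpace ℝ (Fin 3), x ≠ 0 → VectorCalculus.divergence U x = 0)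
    (hhom : ∀ c : ℝ, 0 < c → ∀ x : EuclideanSpace ℝ (Fin 3), U (c • x) = c⁻¹ • U x)
    (hne : ∃ x : EuclideanSpace ℝ (Fin 3), U x ≠ 0) :
    ∃ a : EuclideanSpace ℝ (Fin 3), ‖a‖ = 1 ∧ ∃ A : ℝ, 1 < A ∧
      ∀ x : EuclideanSpace ℝ (Fin 3), x ≠ 0 → U x = ν • landauAxisField a A x :=
  Sverak2011_landauClassification_holds.of_profile hν hU hP hNS hdiv hhom hne

/-! ### The crux in Landau normal form -/

/-- **The crux in Landau normal form** (registered support stub of crux stmt-NavierStokesRegularity-1944,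
line `registered`): `LandauTailBlowup` holds iff for some `ν > 0`, `T > 0` there is a classical solution
of the unforced Navier–Stokes system on `[0, T)`, Leray–Hopf on `[0, T]` from a rapidly decaying datum,
a point `xs`, a unit axis `a` and a parameter `A > 1` such that
`√(T − t) u(t, xs + √(T − t) y) → ν • landauAxisField a A y` as `t → T⁻` for every `y ≠ 0` — the
abstract nonzero `(−1)`-homogeneous steady profile of the route IS a Landau solution (Šverák 2011, Thm 1,
`→`) and every Landau solution is such a profile (Landau 1944, `←`). [folklore] -/
theorem landauTailBlowup_iff_landauAxisField :
    Summit.NavierStokesRegularity.NavierStokesRegularity.Theses.LandauTail.LandauTailBlowup ↔ ∃ ν : ℝ, 0 < ν ∧ ∃ T : ℝ, 0 < T ∧ ∃ (u : ℝ → EuclideanSpace ℝ (Fin 3) → EuclideanSpace ℝ (Fin 3)) (p : ℝ → EuclideanSpace ℝ (Fin 3) → ℝ), Literature.Analysis.FluidPDE.IsClassicalNSSolutionOn (Set.Ico 0 T) ν 0 u p ∧ Literature.Analysis.FluidPDE.IsLerayHopfOn T ν 0 (u 0) u ∧ Literature.Analysis.FluidPDE.HasRapidSpatialDecay (u 0)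 ∧ ∃ (xs : EuclideanSpace ℝ (Fin 3)) (a : EuclideanSpace ℝ (Fin 3)) (A : ℝ), ‖a‖ = 1 ∧ 1 < A ∧ ∀ y : EuclideanSpace ℝ (Fin 3), y ≠ 0 → Filter.Tendsto (fun t : ℝ => Real.sqrt (T - t) • u t (xs + Real.sqrt (T - t) • y)) (nhdsWithin T (Set.Iio T)) (nhds (ν • Literature.Analysis.FluidPDE.landauAxisField a A y)) := by
  unfold Summit.NavierStokesRegularity.NavierStokesRegularity.Theses.LandauTail.LandauTailBlowup
  constructor
  · rintro ⟨ν, hν, T, hT, u, p, hcl, hLH, hdec, xs, U, P, ⟨hU, hP, hNS, hdiv, hhom, hne⟩, htail⟩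
    obtain ⟨a, ha, A, hA, hUeq⟩ := landauTail_exists_axis_of_profile hν hU hP hNS hdiv hhom hne
    refine ⟨ν, hν, T, hT, u, p, hcl, hLH, hdec, xs, a, A, ha, hA, fun y hy => ?_⟩
    rw [← hUeq y hy]
    exact htail y hy
  · rintro ⟨ν, hν, T, hT, u, p, hcl, hLH, hdec, xs, a, A, ha, hA, htail⟩
    obtain ⟨hU, hP, hNS, hdiv, hhom, hne⟩ := landauTail_smul_landauAxisField_profile hν ha hA
    exact ⟨ν, hν, T, hT, u, p, hcl, hLH, hdec, xs, fun x => ν • landauAxisField a A x,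
      fun x => ν ^ 2 * landauAxisPressure a A x, ⟨hU, hP, hNS, hdiv, hhom, hne⟩, htail⟩

/-! ### Rotation covariance of the Tsai local energy bounds and of the tail -/

/-- The Frobenius norm is invariant under conjugation by a linear isometry: `|R ∘ L ∘ R⁻¹|² = |L|²`
(sum over the orthonormal basis `R b`; cf. `frobeniusNormSq_conj_linearIsometryEquiv` in the
axisymmetric Type-I files, restated here to keep their imports out). [folklore] -/
theorem landauTail_frobeniusNormSq_conj (R : EuclideanSpace ℝ (Fin 3) ≃ₗᵢ[ℝ] EuclideanSpace ℝ (Fin 3))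
    (L : EuclideanSpace ℝ (Fin 3) →L[ℝ] EuclideanSpace ℝ (Fin 3)) :
    frobeniusNormSq ((R : EuclideanSpace ℝ (Fin 3) →L[ℝ] EuclideanSpace ℝ (Fin 3)).comp
      (L.comp (R.symm : EuclideanSpace ℝ (Fin 3) →L[ℝ] EuclideanSpace ℝ (Fin 3)))) =
      frobeniusNormSq L := by
  rw [frobeniusNormSq_eq_sum ((stdOrthonormalBasis ℝ (EuclideanSpace ℝ (Fin 3))).map R),
    frobeniusNormSq_eq_sum (stdOrthonormalBasis ℝ (EuclideanSpace ℝ (Fin 3)))]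
  refine Finset.sum_congr rfl fun i _ => ?_
  simp [OrthonormalBasis.map_apply]

/-- Change of variables by a linear isometry in a lower Lebesgue integral over the unit ball:
`∫_{B₁} g (R x) dx = ∫_{B₁} g` (`R` preserves Lebesgue measure and the ball). [folklore] -/
theorem landauTail_setLIntegral_ball_comp_linearIsometryEquiv
    (R : EuclideanSpace ℝ (Fin 3) ≃ₗᵢ[ℝ] EuclideanSpace ℝ (Fin 3)) (g : EuclideanSpace ℝ (Fin 3) → ℝ≥0∞) :
    ∫⁻ x in ball (0 : EuclideanSpace ℝ (Fin 3)) 1, g (R x) =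
      ∫⁻ x in ball (0 : EuclideanSpace ℝ (Fin 3)) 1, g x := by
  have hmp : MeasurePreserving R (volume : Measure (EuclideanSpace ℝ (Fin 3))) volume :=
    R.measurePreserving
  have hemb : MeasurableEmbedding R := R.toHomeomorph.measurableEmbedding
  have hpre : R ⁻¹' ball (0 : EuclideanSpace ℝ (Fin 3)) 1 = ball 0 1 := by
    rw [LinearIsometryEquiv.preimage_ball, map_zero]
  rw [← hmp.setLIntegral_comp_preimage_emb hemb g (ball 0 1), hpre]

/-- **Rotating a local-energy-class solution.** If `(u, p)` is a classical unit-viscosity solution of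
the unforced system on `ℝ³ × (−1, 0)` with Tsai's bounds on `B₁` and the parabolic tail
`√(−t) u(t, √(−t) y) → V y` (`y ≠ 0`), then the conjugate `(t, x) ↦ R (u t (R⁻¹ x))`, `p t (R⁻¹ x)`
is again such a solution, with tail `R (V (R⁻¹ y))` (rotation covariance of the equations,
Majda–Bertozzi Prop. 1.1 (iii), of Lebesgue measure, of `|∇u|²` and of the ball). [folklore] -/
theorem landauTail_local_conj_linearIsometryEquiv
    (R : EuclideanSpace ℝ (Fin 3) ≃ₗᵢ[ℝ] EuclideanSpace ℝ (Fin 3))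
    {u : ℝ → EuclideanSpace ℝ (Fin 3) → EuclideanSpace ℝ (Fin 3)} {p : ℝ → EuclideanSpace ℝ (Fin 3) → ℝ}
    {V : EuclideanSpace ℝ (Fin 3) → EuclideanSpace ℝ (Fin 3)}
    (hcl : IsClassicalNSSolutionOn (Set.Ioo (-1) 0) 1 0 u p)
    (hE : ∃ C : ℝ≥0, ∀ t ∈ Set.Ioo (-1 : ℝ) 0,
      ∫⁻ x in ball (0 : EuclideanSpace ℝ (Fin 3)) 1, ‖u t x‖ₑ ^ 2 ≤ C)
    (hD : ∫⁻ t in Set.Ioo (-1 : ℝ) 0, ∫⁻ x in ball (0 : EuclideanSpace ℝ (Fin 3)) 1,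
      ENNReal.ofReal (frobeniusNormSq (fderiv ℝ (u t) x)) < ⊤)
    (htail : ∀ y : EuclideanSpace ℝ (Fin 3), y ≠ 0 →
      Tendsto (fun t : ℝ => Real.sqrt (0 - t) • u t (Real.sqrt (0 - t) • y)) (𝓝[<] 0) (𝓝 (V y))) :
    IsClassicalNSSolutionOn (Set.Ioo (-1) 0) 1 0 (fun t x => R (u t (R.symm x)))
        (fun t x => p t (R.symm x)) ∧
      (∃ C : ℝ≥0, ∀ t ∈ Set.Ioo (-1 : ℝ) 0,
        ∫⁻ x in ball (0 : EuclideanSpace ℝ (Fin 3)) 1, ‖(fun t x => R (u t (R.symm x))) t x‖ₑ ^ 2 ≤ C) ∧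
      (∫⁻ t in Set.Ioo (-1 : ℝ) 0, ∫⁻ x in ball (0 : EuclideanSpace ℝ (Fin 3)) 1,
        ENNReal.ofReal (frobeniusNormSq (fderiv ℝ ((fun t x => R (u t (R.symm x))) t) x)) < ⊤) ∧
      (∀ y : EuclideanSpace ℝ (Fin 3), y ≠ 0 →
        Tendsto (fun t : ℝ => Real.sqrt (0 - t) • (fun t x => R (u t (R.symm x))) t (Real.sqrt (0 - t) • y))
          (𝓝[<] 0) (𝓝 (R (V (R.symm y))))) := by
  refine ⟨?_, ?_, ?_, ?_⟩
  · exact (hcl.conj_linearIsometryEquiv R (uniqueDiffOn_Ioo (-1) 0)).congr_force fun t _ x => by simp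
  · obtain ⟨C, hC⟩ := hE
    refine ⟨C, fun t ht => ?_⟩
    have h1 : ∫⁻ x in ball (0 : EuclideanSpace ℝ (Fin 3)) 1, ‖R (u t (R.symm x))‖ₑ ^ 2 =
        ∫⁻ x in ball (0 : EuclideanSpace ℝ (Fin 3)) 1, ‖u t x‖ₑ ^ 2 := by
      simp_rw [LinearIsometryEquiv.enorm_map]
      exact landauTail_setLIntegral_ball_comp_linearIsometryEquiv R.symm (fun x => ‖u t x‖ₑ ^ 2)
    simp only
    rw [h1]
    exact hC t ht
  · have h1 : ∀ t, ∫⁻ x in ball (0 : EuclideanSpace ℝ (Fin 3)) 1,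
        ENNReal.ofReal (frobeniusNormSq (fderiv ℝ (fun x => R (u t (R.symm x))) x)) =
        ∫⁻ x in ball (0 : EuclideanSpace ℝ (Fin 3)) 1, ENNReal.ofReal (frobeniusNormSq (fderiv ℝ (u t) x)) := by
      intro t
      simp_rw [fderiv_conj_linearIsometryEquiv R (u t), landauTail_frobeniusNormSq_conj]
      exact landauTail_setLIntegral_ball_comp_linearIsometryEquiv R.symm
        (fun x => ENNReal.ofReal (frobeniusNormSq (fderiv ℝ (u t) x)))
    simp only
    simp_rw [h1]
    exact hD
  · intro y hy
    have hy' : R.symm y ≠ 0 := fun h => hy (by simpa using congrArg R h)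
    have h2 := (R.continuous.tendsto _).comp (htail _ hy')
    refine h2.congr fun t => ?_
    simp only [Function.comp_apply, map_smul]

/-! ### The singularity model is a one-parameter problem -/

/-- **`LandauTailLocal` in Landau normal form** (registered support stub of crux
stmt-NavierStokesRegularity-1944, line `registered`; its hardest stub = item stmt-NavierStokesRegularity-1946
rewritten): `LandauTailLocal` holds iff for some parameter `A > 1` there is a classical unit-viscosity
solution of the unforced Navier–Stokes system on `ℝ³ × (−1, 0)` with Tsai's local energy bounds on `B₁`
(`sup_t ∫_{B₁} |u|² < ∞`, `∫∫_{B₁} |∇u|² < ∞`) whose parabolic blow-up profile at the origin is Landau's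
solution (10.44) with axis `e₃`: `√(−t) u(t, √(−t) y) → landauSolution 1 A y` for every `y ≠ 0`.
`→`: Šverák's theorem puts the profile in the form `landauAxisField a A`; a frame `R` with `R e₃ = a` and
the rotation covariance of the system, of the Tsai bounds and of the tail
(`landauTail_local_conj_linearIsometryEquiv` with `R⁻¹`) turn the axis to `e₃`
(`landauAxisField (R e₃) A (R y) = R (landauAxisField e₃ A y)`). `←`: Landau's theorem. [folklore] -/
theorem landauTailLocal_iff_landauSolution :
    Summit.NavierStokesRegularity.NavierStokesRegularity.Theses.LandauTail.LandauTailLocal ↔ ∃ A : ℝ, 1 < A ∧ ∃ (u : ℝ → EuclideanSpace ℝ (Fin 3) → EuclideanSpace ℝ (Fin 3)) (p : ℝ → EuclideanSpace ℝ (Fin 3) → ℝ), Literature.Analysis.FluidPDE.IsClassicalNSSolutionOn (Set.Ioo (-1) 0) 1 0 u p ∧ (∃ C : NNReal, ∀ t ∈ Set.Ioo (-1 : ℝ) 0, ∫⁻ x in Metric.ball (0 : EuclideanSpace ℝ (Fin 3)) 1, ‖u t x‖ₑ ^ 2 ≤ C) ∧ (∫⁻ t in Set.Ioo (-1 : ℝ)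 0, ∫⁻ x in Metric.ball (0 : EuclideanSpace ℝ (Fin 3)) 1, ENNReal.ofReal (Literature.Analysis.FluidPDE.frobeniusNormSq (fderiv ℝ (u t) x)) < ⊤) ∧ ∀ y : EuclideanSpace ℝ (Fin 3), y ≠ 0 → Filter.Tendsto (fun t : ℝ => Real.sqrt (0 - t) • u t (Real.sqrt (0 - t) • y)) (nhdsWithin 0 (Set.Iio 0)) (nhds (Literature.Analysis.FluidPDE.landauSolution 1 A y)) := by
  unfold Summit.NavierStokesRegularity.NavierStokesRegularity.Theses.LandauTail.LandauTailLocal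
  constructor
  · rintro ⟨u, p, U, P, ⟨hU, hP, hNS, hdiv, hhom, hne⟩, hcl, hE, hD, htail⟩
    obtain ⟨a, ha, A, hA, hUeq⟩ := landauTail_exists_axis_of_profile one_pos hU hP hNS hdiv hhom hne
    obtain ⟨R, hR⟩ := exists_linearIsometryEquiv_apply_eZ_eq ha
    -- conjugate by `S = R⁻¹`, which carries the axis `a` back to `e₃`
    obtain ⟨hcl', hE', hD', htail'⟩ := landauTail_local_conj_linearIsometryEquiv R.symm hcl hE hD htail
    refine ⟨A, hA, _, _, hcl', hE', hD', fun y hy => ?_⟩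
    have hy' : R y ≠ 0 := fun h => hy (by simpa using congrArg R.symm h)
    have key : R.symm (U (R.symm.symm y)) = landauSolution 1 A y := by
      rw [LinearIsometryEquiv.symm_symm, hUeq _ hy', one_smul, ← hR,
        landauAxisField_map_linearIsometryEquiv R eZ A y, LinearIsometryEquiv.symm_apply_apply,
        landauSolution_one]
    rw [← key]
    exact htail' y hy
  · rintro ⟨A, hA, u, p, hcl, hE, hD, htail⟩
    obtain ⟨hU, hP, hNS, hdiv, hhom, hne⟩ := landauTail_landauAxisField_profile LandauTail.norm_eZ_eq_one' hA
    refine ⟨u, p, landauAxisField eZ A, landauAxisPressure eZ A, ⟨hU, hP, hNS, hdiv, hhom, hne⟩,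
      hcl, hE, hD, fun y hy => ?_⟩
    rw [← landauSolution_one]
    exact htail y hy

/-- **The crux is a one-parameter local model plus localisation** (registered support stub of crux
stmt-NavierStokesRegularity-1944): through the tight cut
(`landauTailBlowup_iff_local_and_transfer`) and the Landau normal form of the local model,
`LandauTailBlowup ↔ (∃ A > 1, a unit-viscosity local-energy-class classical solution on ℝ³ × (−1, 0)
with parabolic tail landauSolution 1 A at the origin) ∧ LandauTailTransfer`. [folklore] -/
theorem landauTailBlowup_iff_landauSolution_local_and_transfer :
    Summit.NavierStokesRegularity.NavierStokesRegularity.Theses.LandauTail.LandauTailBlowup ↔ (∃ A : ℝ, 1 < A ∧ ∃ (u : ℝ → EuclideanSpace ℝ (Fin 3) → EuclideanSpace ℝ (Fin 3)) (p : ℝ → EuclideanSpace ℝ (Fin 3) → ℝ), Literature.Analysis.FluidPDE.IsClassicalNSSolutionOn (Set.Ioo (-1) 0) 1 0 u p ∧ (∃ C : NNReal, ∀ t ∈ Set.Ioo (-1 : ℝ) 0, ∫⁻ x in Metric.ball (0 : EuclideanSpace ℝ (Fin 3)) 1, ‖u t x‖ₑ ^ 2 ≤ C) ∧ (∫⁻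 t in Set.Ioo (-1 : ℝ) 0, ∫⁻ x in Metric.ball (0 : EuclideanSpace ℝ (Fin 3)) 1, ENNReal.ofReal (Literature.Analysis.FluidPDE.frobeniusNormSq (fderiv ℝ (u t) x)) < ⊤) ∧ ∀ y : EuclideanSpace ℝ (Fin 3), y ≠ 0 → Filter.Tendsto (fun t : ℝ => Real.sqrt (0 - t) • u t (Real.sqrt (0 - t) • y)) (nhdsWithin 0 (Set.Iio 0)) (nhds (Literature.Analysis.FluidPDE.landauSolution 1 A y))) ∧ Summit.NavierStokesRegularity.NavierStokesRegularity.Theses.LandauTail.LandauTailTransfer := by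
  rw [landauTailBlowup_iff_local_and_transfer, landauTailLocal_iff_landauSolution]

end Summit.NavierStokesRegularity.NavierStokesRegularity.Theorems

end
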